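import Mathlib
import HarnessLib
import Summits.CriticalPhenomena.SAWScalingLimit.Theses.SAWSpinMonotone
import Summits.CriticalPhenomena.SAWScalingLimit.Theses.SAWDevelopingMap
import Literature.Probability.RandomPlanarGeometry.HexParafermion

/-!
# Sketch — crux-ideate stmt-CriticalPhenomena-16772 (`QCIdentification`), round 1, ideator k = 1

First lemmas (statements only; they must elaborate, not be proved) for the two idea cards

* `inclusion-sandwich-slope-only-twist`  (lever: domain monotonicity of POSITIVE boundary
  generating functions across three nested same-slope walls forbids a boundary-condition-changing
  weight at an artificial junction ⇒ the boundary twist depends on the slope only; mesoscopic zigzag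
  faceting then makes it zero) — first lemmas `ArcMonotone` (engine, provable now) and
  `StaircaseArcBalance` (the lattice statement the line delivers = zero twist for digital
  half-planes of every slope; its `α = 79.1°` instance is the cheapest falsifier);
* `strip-differencing-reversal` (lever: width-difference of the DCS strip identity with the SOURCE
  ON the wall + walk reversal) — first lemmas `ArcReversal` (engine, provable now) and
  `ArrivalRatioLocality` (the load-bearing positivity-land stub: boundary-Harnack-type ratio
  locality of SAW arrivals).

All constants `lean search --decl`-verified: `hexParafermionicObservable`, `hexCriticalFugacity`,
`hexDomainBoundary`, `hexDomainMidEdges`, `hexDomainSimplyConnected`, `hexMidpoint`, `hexCenter`,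
`hexGraph` (HexParafermion.lean / TriangularLattice.lean).
-/

open scoped BigOperators
open Literature.Probability.LatticeModels Literature.Probability.RandomPlanarGeometry
open Literature.Probability.RandomPlanarGeometry.SAW

namespace Summit.CriticalPhenomena.SAWScalingLimit.Cruxes.QCIdentification.SketchIdeator16772k1

/-- The POSITIVE boundary/bulk generating function `Z_Λ(a → p) = Σ_{γ ⊂ Λ : a → p} x_c^{ℓ(γ)}`:
the spin-0 observable at the critical fugacity (real by `hexParafermionicObservable_zero_spin`). -/
noncomputable def Zgen (Λ : Finset HexVertex) (a p : Sym2 HexVertex) : ℝ :=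
  (hexParafermionicObservable Λ a hexCriticalFugacity 0 p).re

/-- The three neighbours of a hexagonal-lattice vertex (copied from `Lines/eight_fifths_primitive.lean`). -/
def hexNbr (v : HexVertex) (k : Fin 3) : HexVertex :=
  if v.2 = 0 then
    ![(v.1, 1), (v.1 - Pi.single 0 1, 1), (v.1 - Pi.single 1 1, 1)] k
  else
    ![(v.1, 0), (v.1 + Pi.single 0 1, 0), (v.1 + Pi.single 1 1, 0)] k

/-! ## Card A — inclusion sandwich -/

/-- **Engine of card A (exact, provable now): domain monotonicity of the positive generating
function.** Enlarging the vertex set can only add walks: `Z_Λ(a → p) ≤ Z_{Λ'}(a → p)` for `Λ ⊆ Λ'`.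
(Injection `HexMidEdgeSAW Λ a p ↪ HexMidEdgeSAW Λ' a p`, same `verts`; `x_c ≥ 0`.) This is the ONLY
self-avoiding-walk input of the sandwich: it replaces the unitarity the SAW does not have
(barrier `SAWNoUnitaryCFT`) by ORDER positivity. -/
def ArcMonotone : Prop :=
  ∀ (Λ Λ' : Finset HexVertex), Λ ⊆ Λ' → ∀ a p : Sym2 HexVertex, Zgen Λ a p ≤ Zgen Λ' a p

/-- The zero-twist weight of the dangling edge `v → u` (`v ∈ Λ`, `u ∉ Λ`) for a wall of macroscopic
direction `α` (domain on the LEFT of `e^{iα}`, outward normal `θ_n = α − π/2`):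
`sin((3/8)·(Θ(u − v) − θ_n))`, principal determination of the angle difference. -/
noncomputable def danglingWeight (α : ℝ) (v u : HexVertex) : ℝ :=
  Real.sin (3 / 8 * Complex.arg ((hexCenter u - hexCenter v) *
    Complex.exp (-(((α - Real.pi / 2 : ℝ) : ℂ) * Complex.I))))

/-- **`StaircaseArcBalance` — zero twist for the digital half-plane of EVERY slope (the lattice
statement card A delivers; typed cheapest falsifier).** For every direction `α` and `ε > 0` there is a
window radius `r₀` such that for every `r ≥ r₀` there is `R` with: whenever the simply connected `Λ`
coincides, within Euclidean radius `R` of `z₀`, with the digital half-plane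
`{w | c ≤ Im(e^{-iα}·hexCenter w)}` (a Christoffel staircase wall of slope `α` through the window), and
the boundary source `a` is at distance `≥ R` from `z₀`, the `sin((3/8)(Θ_p − θ_n))`-weighted sum of the
POSITIVE arrival generating functions `Z_Λ(a → p)` over the dangling mid-edges `p` in the window of
radius `r` is at most `ε` times their unweighted sum — i.e. `arg Σ_p Z_p e^{i(3/8)Θ_p} = (3/8)θ_n + o(1)`:
the developed boundary runs in the conformal direction. Symmetric slopes (`α ∈ 30°ℤ`) hold by
mirror symmetry + lateral universality; `α = 79.1°` (word `(60,60,120)`) predicts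
`S₆₀/S₁₂₀ → sin(15.33°)/sin(7.17°) = 2.12` per period — untested. Vacuity: a disconnected far source
gives `0 ≤ 0`. Proved reach of the line: rational slopes (periodic staircases). -/
def StaircaseArcBalance : Prop :=
  ∀ α ε : ℝ, 0 < ε → ∃ r₀ : ℝ, ∀ r : ℝ, r₀ ≤ r → ∃ R : ℝ,
    ∀ (Λ : Finset HexVertex) (z₀ : ℂ) (c : ℝ) (a : Sym2 HexVertex),
      hexDomainSimplyConnected Λ → a ∈ hexDomainBoundary Λ →
      (∀ w : HexVertex, dist (hexCenter w) z₀ ≤ R →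
        (w ∈ Λ ↔ c ≤ (hexCenter w * Complex.exp (-((α : ℂ) * Complex.I))).im)) →
      R ≤ dist (hexMidpoint a) z₀ →
      |∑ v ∈ Λ, ∑ k : Fin 3,
          (if hexNbr v k ∉ Λ ∧ dist (hexMidpoint s(v, hexNbr v k)) z₀ ≤ r then
            danglingWeight α v (hexNbr v k) * Zgen Λ a s(v, hexNbr v k) else 0)| ≤
        ε * ∑ v ∈ Λ, ∑ k : Fin 3,
          (if hexNbr v k ∉ Λ ∧ dist (hexMidpoint s(v, hexNbr v k)) z₀ ≤ r then
            Zgen Λ a s(v, hexNbr v k) else 0)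

/-- **`JunctionNoWeight` — the sandwich's lattice output, typed without exponents.** Two digital
half-planes of the SAME slope `α` (offsets `c₁` for `Re`-coordinate `< s₀`, `c₂` for `≥ s₀`, glued at
an artificial junction near `z₀`): along the common `c₂`-part, the ratio of arrivals in the junction
domain to arrivals in the pure `c₂`-half-plane stays BOUNDED ABOVE AND BELOW, uniformly in the
distance `r` from the junction and in the (far) source — no power law `r^{±Δ/π}`, hence (given the
Riemann–Hilbert identification with free twist data) equal twists `t(c₁-wall) = t(c₂-wall)`.
The two inequalities ARE `ArcMonotone` once `c₁` is moved below / above `c₂` (nesting); the content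
is that the constant does not depend on `r`. -/
def JunctionNoWeight : Prop :=
  ∀ α c₁ c₂ : ℝ, ∃ C : ℝ, 0 < C ∧ ∀ r : ℝ, 0 < r → ∃ R : ℝ,
    ∀ (Λ Λ₂ : Finset HexVertex) (z₀ : ℂ) (s₀ : ℝ) (a p : Sym2 HexVertex),
      hexDomainSimplyConnected Λ → hexDomainSimplyConnected Λ₂ →
      a ∈ hexDomainBoundary Λ → a ∈ hexDomainBoundary Λ₂ →
      p ∈ hexDomainBoundary Λ → p ∈ hexDomainBoundary Λ₂ →
      -- `Λ₂` is the pure `c₂`-half-plane and `Λ` the junction domain, within radius `R` of `z₀`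
      (∀ w : HexVertex, dist (hexCenter w) z₀ ≤ R →
        ((w ∈ Λ₂ ↔ c₂ ≤ (hexCenter w * Complex.exp (-((α : ℂ) * Complex.I))).im) ∧
         (w ∈ Λ ↔ (if (hexCenter w * Complex.exp (-((α : ℂ) * Complex.I))).re < s₀ then c₁ else c₂) ≤
            (hexCenter w * Complex.exp (-((α : ℂ) * Complex.I))).im))) →
      -- `p` on the common part at distance `r` from the junction, the source far on the common side
      s₀ + r ≤ (hexMidpoint p * Complex.exp (-((α : ℂ) * Complex.I))).re →
      dist (hexMidpoint p) z₀ ≤ 2 * r →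
      s₀ + R / 2 ≤ (hexMidpoint a * Complex.exp (-((α : ℂ) * Complex.I))).re →
      dist (hexMidpoint a) z₀ ≤ R →
      Zgen Λ a p ≤ C * Zgen Λ₂ a p ∧ Zgen Λ₂ a p ≤ C * Zgen Λ a p

/-! ## Card B — strip differencing + reversal -/

/-- **Engine of card B (exact, provable now): walk reversal.** `Z_Λ(a → p) = Z_Λ(p → a)` for
mid-edges of the domain (reverse `verts`; length is preserved; at spin 0 no winding enters). -/
def ArcReversal : Prop :=
  ∀ (Λ : Finset HexVertex) (a p : Sym2 HexVertex),
    a ∈ hexDomainMidEdges Λ → p ∈ hexDomainMidEdges Λ → Zgen Λ a p = Zgen Λ p a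

/-- **`ArrivalRatioLocality` — the load-bearing positivity-land stub of card B (landing-class
factorisation; a boundary-Harnack principle for critical SAW arrivals).** On a window of radius `r`
of a digital wall of slope `α`, the RATIOS of arrival generating functions at two dangling mid-edges
`p, p'` do not depend on the far source: for sources `a, a'` at distance `≥ R`,
`Z(a→p)·Z(a'→p') = Z(a'→p)·Z(a→p')` up to relative error `ε`. (For simple random walk this is the
boundary Harnack inequality with constants → 1; for the SAW it is Kennedy–Lawler locality of the
boundary factor, here needed only as source-independence of ratios, and for bridges it is Kesten's
irreducible-bridge renewal.) Vacuity: vanishing `Z` give `0 ≤ 0`. -/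
def ArrivalRatioLocality : Prop :=
  ∀ α ε r : ℝ, 0 < ε → 0 < r → ∃ R : ℝ,
    ∀ (Λ : Finset HexVertex) (z₀ : ℂ) (c : ℝ) (a a' p p' : Sym2 HexVertex),
      hexDomainSimplyConnected Λ →
      a ∈ hexDomainBoundary Λ → a' ∈ hexDomainBoundary Λ →
      p ∈ hexDomainBoundary Λ → p' ∈ hexDomainBoundary Λ →
      (∀ w : HexVertex, dist (hexCenter w) z₀ ≤ R →
        (w ∈ Λ ↔ c ≤ (hexCenter w * Complex.exp (-((α : ℂ) * Complex.I))).im)) →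
      dist (hexMidpoint p) z₀ ≤ r → dist (hexMidpoint p') z₀ ≤ r →
      R ≤ dist (hexMidpoint a) z₀ → R ≤ dist (hexMidpoint a') z₀ →
      |Zgen Λ a p * Zgen Λ a' p' - Zgen Λ a' p * Zgen Λ a p'| ≤ ε * (Zgen Λ a p' * Zgen Λ a' p')

/-! ## Sanity: the objects are the crux's objects -/

example : Summit.CriticalPhenomena.SAWScalingLimit.Theses.SAWSpinMonotone.QCIdentification ↔
    Summit.CriticalPhenomena.SAWScalingLimit.Theses.SAWDevelopingMap.QCIdentification := Iff.rfl

end Summit.CriticalPhenomena.SAWScalingLimit.Cruxes.QCIdentification.SketchIdeator16772k1
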